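import Literature.NumberTheory.Sieve.FriedlanderIwaniecPrimesUdSeparable
import HarnessLib

/-!
# Friedlander–Iwaniec, *The polynomial `X² + Y⁴` captures its primes*, §16: the skeleton of (16.15) —
# `U(β)` against `Σ_{|k| ≤ K} û(k) Σ_{d ≤ X} 2φ(d)/d · S_d^0(k)` with every discarded term an explicit finite sum

Source: J. Friedlander, H. Iwaniec, Ann. of Math. (2) 148 (1998), 945–1040 [FriedlanderIwaniecAnnals1998]
(= arXiv:math/9811185), §16 pp. 58–60, (16.1)–(16.10) and (16.15):

> "Inserting (16.11) in (16.10) and the latter in (16.1) we arrive at the formula (16.15)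
> `U(β) = Σ_{|k| ≤ K} û(k) Σ_{d ≤ X} 2φ(d)/(dΦ(d)) Σ_{χ (mod 4d)} 𝒥(χ) |S_χ^k(β)|² + O((P⁻¹ + H⁻¹ + K⁻¹H²)N² log N)`."

This file assembles the tree's pieces — (16.1) `fiU_eq_sum_fiUd`, the mollification cost
`abs_fiUd_sub_fiUdMoll_le`, the cost of dropping `f` and `(z₁,z₂) = 1` `abs_fiUdMoll_sub_fiUd0_le`, and the
truncated separation `exists_fiUd0_trunc` (`…UdDecomposition`, `…UdSeparable`) — into ONE inequality
**`exists_fiU_sub_main_le`**: for an absolute `C` and, for each `H ≥ 2`, one coefficient sequence `û_H`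
(`|û_H(k)| ≤ log 4H`, `Σ|û_H| ≤ C log²(4H)`), for all `X > 0`, finite `S ∌ 0`, real `b`, `K ≥ 1`:
`‖U(β) - Σ_{|k| ≤ K} û_H(k) Σ_{1 ≤ d ≤ X} (2φ(d)/d) S_d^0(k)‖ ≤ Σ_{1 ≤ d ≤ X} (2φ(d)/d)·[E₁(d) + log(4H)·E₂(d) + C·H·log(4H)·K⁻¹·A(d)]`
with the near-diagonal sum `E₁(d) = ΣΣ_{(z₁,z₂)=1, 4d∣Δ≠0, |z₁z₂| > H|Δ|} f |b b| log(2|z₁z₂|)`, the dropped pairs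
`E₂(d) = ΣΣ_{4d∣Δ≠0, (z₁,z₂)≠1 or |Δ|<4dX} |b b|`, and the trivial mass `A(d) = ΣΣ_{4d∣Δ} |b b χ_d|`.  The character
form of `S_d^0(k)` ((16.11), `fiSd0_eq_sum_mulChar`, `…UdCharacters`) is then inserted `d` by `d`.  In print the three
error sums are `O(d⁻¹H⁻¹N²)`, `O(d⁻¹P⁻¹N²)` (+ near-diagonal) and `O(d⁻¹K⁻¹H²N²)` by lattice-point counts in the box
(5.14), which are not part of this file.  No named facts, no `sorry`.

## References
* J. Friedlander, H. Iwaniec, Ann. of Math. (2) 148 (1998), 945–1040, §16 (16.1)–(16.10), (16.15). [FriedlanderIwaniecAnnals1998]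
-/

noncomputable section

open Real Complex Finset
open scoped ComplexConjugate

namespace Literature.NumberTheory.Sieve.FriedlanderIwaniecPrimes

/-- The near-diagonal sum discarded by the mollification (cost of (16.6), first part).
[cite: FriedlanderIwaniecAnnals1998, (16.6) (`O(d⁻¹H⁻¹N²)`)] -/
def fiUdErrNear (X H : ℝ) (d : ℕ) (S : Finset GaussianInt) (b : GaussianInt → ℝ) : ℝ :=
  ∑ z₁ ∈ S, ∑ z₂ ∈ S,
    if GaussCoprime z₁ z₂ ∧ d ∈ fiModuli z₁ z₂ ∧ H * |(fiDelta z₁ z₂ : ℝ)| < fiAbsProd z₁ z₂ then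
      fiTenF X (|(fiDelta z₁ z₂ : ℝ)| / d) * |b z₁ * b z₂| * Real.log (2 * fiAbsProd z₁ z₂)
    else 0

/-- The mass of the pairs discarded with `f` and `(z₁,z₂) = 1` (cost of (16.6), second part).
[cite: FriedlanderIwaniecAnnals1998, (16.6) (`O(d⁻¹P⁻¹N²)`; "the factor `f(|Δ|/d)` is not needed")] -/
def fiUdErrDrop (X : ℝ) (d : ℕ) (S : Finset GaussianInt) (b : GaussianInt → ℝ) : ℝ :=
  ∑ z₁ ∈ S, ∑ z₂ ∈ S,
    if d ∈ fiModuli z₁ z₂ ∧ (¬ GaussCoprime z₁ z₂ ∨ |(fiDelta z₁ z₂ : ℝ)| < 4 * d * X) then |b z₁ * b z₂| else 0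

/-- The trivial mass of the block (multiplies the truncation error `K⁻¹`).
[cite: FriedlanderIwaniecAnnals1998, (16.9)–(16.10) (`O(d⁻¹K⁻¹H²N²)`)] -/
def fiUdMass (d : ℕ) (S : Finset GaussianInt) (b : GaussianInt → ℝ) : ℝ :=
  ∑ i ∈ S ×ˢ S, |(if (4 * (d : ℤ)) ∣ fiDelta i.1 i.2 then b i.1 * b i.2 * (fiChi d i.1 i.2 : ℝ) else 0 : ℝ)|

/-- **The skeleton of (16.15).**  [cite: FriedlanderIwaniecAnnals1998, (16.1)–(16.10) and (16.15)] -/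
theorem exists_fiU_sub_main_le : ∃ C : ℝ, 0 < C ∧ ∀ H : ℝ, 2 ≤ H →
    ∃ c : ℤ → ℂ, (∀ k, ‖c k‖ ≤ Real.log (4 * H)) ∧ (Summable fun k => ‖c k‖) ∧
      (∑' k : ℤ, ‖c k‖ ≤ C * Real.log (4 * H) ^ 2) ∧
      ∀ (X : ℝ), 0 < X → ∀ (S : Finset GaussianInt), (0 : GaussianInt) ∉ S →
        ∀ (b : GaussianInt → ℝ) (K : ℕ), 1 ≤ K →
          ‖(fiU X S b : ℂ) - ∑ k ∈ Finset.Icc (-(K : ℤ)) K, c k *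
              ∑ d ∈ Finset.Icc 1 ⌊X⌋₊, ((2 * (d.totient : ℝ) / d : ℝ) : ℂ) * fiSd0 d S b k‖ ≤
            ∑ d ∈ Finset.Icc 1 ⌊X⌋₊, (2 * (d.totient : ℝ) / d) *
              (fiUdErrNear X H d S b + Real.log (4 * H) * fiUdErrDrop X d S b +
                C * H * Real.log (4 * H) / K * fiUdMass d S b) := by
  obtain ⟨C, hC, hmain⟩ := exists_fiUd0_trunc
  refine ⟨C, hC, fun H hH => ?_⟩
  obtain ⟨c, hc0, hsum, htsum, htrunc⟩ := hmain H hH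
  refine ⟨c, hc0, hsum, htsum, fun X hX S h0 b K hK => ?_⟩
  have hH0 : 0 < H := by linarith
  have hH1 : 1 ≤ H := by linarith
  -- per block
  have hblock : ∀ d ∈ Finset.Icc 1 ⌊X⌋₊,
      ‖(fiUd X d S b : ℂ) - ∑ k ∈ Finset.Icc (-(K : ℤ)) K, c k * fiSd0 d S b k‖ ≤
        fiUdErrNear X H d S b + Real.log (4 * H) * fiUdErrDrop X d S b +
          C * H * Real.log (4 * H) / K * fiUdMass d S b := by
    intro d hd
    rw [Finset.mem_Icc] at hd
    have h1 : |fiUd X d S b - fiUdMoll X H d S b| ≤ fiUdErrNear X H d S b :=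
      abs_fiUd_sub_fiUdMoll_le hH0 X d S b
    have h2 : |fiUdMoll X H d S b - fiUd0 H d S b| ≤ Real.log (4 * H) * fiUdErrDrop X d S b :=
      abs_fiUdMoll_sub_fiUd0_le hX hH1 hd.1 h0 b
    have h3 := htrunc d S h0 b K hK
    have e : (fiUd X d S b : ℂ) - ∑ k ∈ Finset.Icc (-(K : ℤ)) K, c k * fiSd0 d S b k =
        ((fiUd X d S b - fiUdMoll X H d S b : ℝ) : ℂ) + ((fiUdMoll X H d S b - fiUd0 H d S b : ℝ) : ℂ) +
          ((fiUd0 H d S b : ℂ) - ∑ k ∈ Finset.Icc (-(K : ℤ)) K, c k * fiSd0 d S b k) := by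
      push_cast; ring
    rw [e]
    refine (norm_add₃_le).trans ?_
    rw [Complex.norm_real, Complex.norm_real, Real.norm_eq_abs, Real.norm_eq_abs]
    unfold fiUdMass
    linarith
  -- assemble over `d`
  have hre : (fiU X S b : ℂ) - ∑ k ∈ Finset.Icc (-(K : ℤ)) K, c k *
        ∑ d ∈ Finset.Icc 1 ⌊X⌋₊, ((2 * (d.totient : ℝ) / d : ℝ) : ℂ) * fiSd0 d S b k =
      ∑ d ∈ Finset.Icc 1 ⌊X⌋₊, ((2 * (d.totient : ℝ) / d : ℝ) : ℂ) *
        ((fiUd X d S b : ℂ) - ∑ k ∈ Finset.Icc (-(K : ℤ)) K, c k * fiSd0 d S b k) := by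
    rw [fiU_eq_sum_fiUd]
    push_cast
    simp_rw [mul_sub, Finset.mul_sum, Finset.sum_sub_distrib]
    congr 1
    · exact sum_congr rfl fun d _ => by ring
    · rw [Finset.sum_comm]
      exact sum_congr rfl fun d _ => sum_congr rfl fun k _ => by ring
  rw [hre]
  refine (norm_sum_le _ _).trans (sum_le_sum fun d hd => ?_)
  rw [norm_mul, Complex.norm_real, Real.norm_eq_abs,
    abs_of_nonneg (by positivity : (0 : ℝ) ≤ 2 * (d.totient : ℝ) / d)]
  exact mul_le_mul_of_nonneg_left (hblock d hd) (by positivity)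

end Literature.NumberTheory.Sieve.FriedlanderIwaniecPrimes
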